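import Mathlib
import HarnessLib

/-!
# Galdi's Liouville problem ⟨0895⟩, line «all-axes cylinder budget», piece O1c (5a/·):
# the swirl-excess DENSITY of the one-stroke test function — pointwise algebra and zone bounds

Route `GaldiLiouvilleGate`, items ⟨0895⟩/⟨0896⟩; LINE allaxes/cylbudget, combined Defs v3.1
(817120c4c833a18a), obligation O1c′ `CylinderBookkeepingSplit` (BLUEPRINT Remark 15, Thm 7).  With
`ψ = χ(x₂)M(s)`, `s = x₀² + x₁²`, `N = 2M′`, the tested integrand `(P − c)Δψ + D²ψ(U,U)` (pieces 1 and 4)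
splits as `χ·W + E`, where, with `ρ = x₀U₀ + x₁U₁`, `Γ = x₀U₁ − x₁U₀` (the swirl), `Q = P − c + |U|²/2`,

  `W = 2(N + sN′)·Q + N′·(ρ² − Γ²) − (N + sN′)·U₂²`,  `E = χ″M(P − c) + 2χ′NρU₂ + χ″MU₂²`

(`density_decomposition`, a ring identity using `ρ² + Γ² = s(U₀² + U₁²)`).  Zone bounds, all pure
real-number inequalities in the deficit `h = c − P ≥ |Q|, |U|²/2` (head principle `Q ≤ 0`):
`density_core` (`N = 1`: `W = 2Q − U₂²`), `density_transition_le` (`W ≤ 6A h`), `density_clean_eq`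
(`N = c₁/s`: `W = (c₁/s²)(Γ² − ρ²) ≤ c₁Γ²/s²`), `density_taper_le` (`W ≤ (4Ac₁/T²) h + A c₁ Γ²/s²`),
`density_error_le` (`|E| ≤ (3DB + 32DT) h` on `s ≤ 4T²`).

[folklore]  No summit / no ⟨0895⟩–⟨0896⟩ claim is proved here; NS regularity is not touched.
-/

noncomputable section

-- the problem directory repeats the summit name (D-0017); core's `dupNamespace` linter fires
set_option linter.dupNamespace false

namespace Summit.NavierStokesRegularity.NavierStokesRegularity.Theorems.GaldiLiouville.AllAxesBudget

/-- **The decomposition of the tested integrand** `(P − c)Δψ + D²ψ(U,U) = χ·W + E` (module docstring;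
`Δψ`, `D²ψ(U,U)` in the form delivered by `laplacian_cylTest` / `hessian_cylTest_apply`). [folklore] -/
theorem density_decomposition (χ χ' χ'' Mv Nv N'v P c x₀ x₁ U₀ U₁ U₂ : ℝ) :
    (P - c) * (χ * (2 * Nv + 2 * (x₀ ^ 2 + x₁ ^ 2) * N'v) + χ'' * Mv) +
      (χ * (Nv * (U₀ ^ 2 + U₁ ^ 2) + 2 * N'v * (x₀ * U₀ + x₁ * U₁) ^ 2) +
        2 * χ' * Nv * ((x₀ * U₀ + x₁ * U₁) * U₂) + χ'' * Mv * U₂ ^ 2) =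
    χ * (2 * (Nv + (x₀ ^ 2 + x₁ ^ 2) * N'v) * (P - c + (U₀ ^ 2 + U₁ ^ 2 + U₂ ^ 2) / 2) +
        N'v * ((x₀ * U₀ + x₁ * U₁) ^ 2 - (x₀ * U₁ - x₁ * U₀) ^ 2) -
        (Nv + (x₀ ^ 2 + x₁ ^ 2) * N'v) * U₂ ^ 2) +
      (χ'' * Mv * (P - c) + 2 * χ' * Nv * ((x₀ * U₀ + x₁ * U₁) * U₂) + χ'' * Mv * U₂ ^ 2) := by
  ring

/-- The Lagrange identity `ρ² + Γ² = s (U₀² + U₁²)`. [folklore] -/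
theorem rho_sq_add_swirl_sq (x₀ x₁ U₀ U₁ : ℝ) :
    (x₀ * U₀ + x₁ * U₁) ^ 2 + (x₀ * U₁ - x₁ * U₀) ^ 2 = (x₀ ^ 2 + x₁ ^ 2) * (U₀ ^ 2 + U₁ ^ 2) := by
  ring

/-- **Core zone** (`N = 1`, `N′ = 0`): `W = 2Q − U₂²`. [folklore] -/
theorem density_core (s Q ρ Γ U₂ : ℝ) :
    2 * ((1 : ℝ) + s * 0) * Q + 0 * (ρ ^ 2 - Γ ^ 2) - (1 + s * 0) * U₂ ^ 2 = 2 * Q - U₂ ^ 2 := by ring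

/-- **Transition zone**: with `|s N′| ≤ A`, `|N + sN′| ≤ A`, the head sign `Q ≤ 0`, `P − c ≤ Q`
(so `h := c − P` dominates `|Q|` and `|U|²/2`), and `ρ² + Γ² = s(U₀²+U₁²)`:
`W ≤ 6 A h`. [folklore] -/
theorem density_transition_le {Nv N'v s A P c Q U₀ U₁ U₂ x₀ x₁ : ℝ} (hs : 0 ≤ s)
    (hsN' : |s * N'v| ≤ A) (hNsN' : |Nv + s * N'v| ≤ A)
    (hQ : Q ≤ 0) (hPQ : P - c ≤ Q) (hQdef : Q = P - c + (U₀ ^ 2 + U₁ ^ 2 + U₂ ^ 2) / 2)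
    (hsx : s = x₀ ^ 2 + x₁ ^ 2) :
    2 * (Nv + s * N'v) * Q + N'v * ((x₀ * U₀ + x₁ * U₁) ^ 2 - (x₀ * U₁ - x₁ * U₀) ^ 2) -
        (Nv + s * N'v) * U₂ ^ 2 ≤ 6 * A * (c - P) := by
  have hA0 : 0 ≤ A := (abs_nonneg _).trans hsN'
  have hh : 0 ≤ c - P := by linarith
  have hU2 : U₀ ^ 2 + U₁ ^ 2 + U₂ ^ 2 ≤ 2 * (c - P) := by nlinarith
  obtain ⟨k1, k2⟩ := abs_le.1 hNsN'
  set k := Nv + s * N'v with hk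
  set ρ := x₀ * U₀ + x₁ * U₁ with hρ
  set Γ := x₀ * U₁ - x₁ * U₀ with hΓ
  have hlag : ρ ^ 2 + Γ ^ 2 = s * (U₀ ^ 2 + U₁ ^ 2) := by rw [hρ, hΓ, hsx]; ring
  -- term 1: `2kQ ≤ 2A(-Q) ≤ 2A h`
  have h1 : 2 * k * Q ≤ 2 * A * (c - P) := by
    have : 0 ≤ (A + k) * (-Q) := mul_nonneg (by linarith) (by linarith)
    nlinarith
  -- term 2: `N′(ρ² − Γ²) ≤ |N′|(ρ² + Γ²) = |sN′|(U₀²+U₁²) ≤ 2 A h`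
  have h2 : N'v * (ρ ^ 2 - Γ ^ 2) ≤ 2 * A * (c - P) := by
    have e1 : N'v * (ρ ^ 2 - Γ ^ 2) ≤ |N'v| * (ρ ^ 2 + Γ ^ 2) := by
      rcases le_or_gt 0 N'v with h | h
      · rw [abs_of_nonneg h]; nlinarith [sq_nonneg ρ, sq_nonneg Γ]
      · rw [abs_of_neg h]; nlinarith [sq_nonneg ρ, sq_nonneg Γ]
    have e2 : |N'v| * (ρ ^ 2 + Γ ^ 2) = |s * N'v| * (U₀ ^ 2 + U₁ ^ 2) := by
      rw [hlag, abs_mul, abs_of_nonneg hs]; ring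
    have e3 : |s * N'v| * (U₀ ^ 2 + U₁ ^ 2) ≤ A * (2 * (c - P)) :=
      mul_le_mul hsN' (by nlinarith) (by positivity) hA0
    linarith
  -- term 3: `−k U₂² ≤ A U₂² ≤ 2 A h`
  have h3 : -(k * U₂ ^ 2) ≤ 2 * A * (c - P) := by
    have : 0 ≤ (A + k) * U₂ ^ 2 := mul_nonneg (by linarith) (sq_nonneg _)
    nlinarith
  linarith

/-- **Clean zone** (`N = c₁/s`, `N′ = −c₁/s²`, `s > 0`): `W = (c₁/s²)(Γ² − ρ²) ≤ c₁ Γ²/s²`. [folklore] -/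
theorem density_clean_le {c₁ s Q ρ Γ U₂ : ℝ} (hs : 0 < s) (hc : 0 ≤ c₁) :
    2 * (c₁ / s + s * -(c₁ / s ^ 2)) * Q + -(c₁ / s ^ 2) * (ρ ^ 2 - Γ ^ 2) -
        (c₁ / s + s * -(c₁ / s ^ 2)) * U₂ ^ 2 ≤ c₁ * (Γ ^ 2 / s ^ 2) := by
  have h0 : c₁ / s + s * -(c₁ / s ^ 2) = 0 := by field_simp; ring
  rw [h0]
  have : -(c₁ / s ^ 2) * (ρ ^ 2 - Γ ^ 2) = c₁ * (Γ ^ 2 / s ^ 2) - c₁ / s ^ 2 * ρ ^ 2 := by ring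
  rw [this]
  have : 0 ≤ c₁ / s ^ 2 * ρ ^ 2 := by positivity
  linarith

/-- **Taper zone** (`|N + sN′| ≤ A c₁/T²`, `N′ ≤ 0`, `−s²N′ ≤ A c₁`, `s > 0`, head sign): 
`W ≤ (4 A c₁/T²) h + A c₁ Γ²/s²`. [folklore] -/
theorem density_taper_le {Nv N'v s A c₁ T P c Q ρ Γ U₀ U₁ U₂ : ℝ} (hs : 0 < s)
    (hNsN' : |Nv + s * N'v| ≤ A * c₁ / T ^ 2) (hN' : N'v ≤ 0) (hs2N' : -(s ^ 2 * N'v) ≤ A * c₁)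
    (hQ : Q ≤ 0) (hPQ : P - c ≤ Q) (hQdef : Q = P - c + (U₀ ^ 2 + U₁ ^ 2 + U₂ ^ 2) / 2) :
    2 * (Nv + s * N'v) * Q + N'v * (ρ ^ 2 - Γ ^ 2) - (Nv + s * N'v) * U₂ ^ 2 ≤
      4 * A * c₁ / T ^ 2 * (c - P) + A * c₁ * (Γ ^ 2 / s ^ 2) := by
  have hB0 : 0 ≤ A * c₁ / T ^ 2 := (abs_nonneg _).trans hNsN'
  have hh : 0 ≤ c - P := by linarith
  have hU2 : U₂ ^ 2 ≤ 2 * (c - P) := by nlinarith [sq_nonneg U₀, sq_nonneg U₁]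
  have h1 : 2 * (Nv + s * N'v) * Q ≤ 2 * (A * c₁ / T ^ 2) * (c - P) := by
    obtain ⟨k1, k2⟩ := abs_le.1 hNsN'
    have : 0 ≤ (A * c₁ / T ^ 2 + (Nv + s * N'v)) * (-Q) := mul_nonneg (by linarith) (by linarith)
    nlinarith
  have h2 : N'v * (ρ ^ 2 - Γ ^ 2) ≤ A * c₁ * (Γ ^ 2 / s ^ 2) := by
    have e : N'v * (ρ ^ 2 - Γ ^ 2) = N'v * ρ ^ 2 + -(s ^ 2 * N'v) * (Γ ^ 2 / s ^ 2) := by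
      field_simp; ring
    rw [e]
    have : N'v * ρ ^ 2 ≤ 0 := mul_nonpos_of_nonpos_of_nonneg hN' (sq_nonneg _)
    have : -(s ^ 2 * N'v) * (Γ ^ 2 / s ^ 2) ≤ A * c₁ * (Γ ^ 2 / s ^ 2) :=
      mul_le_mul_of_nonneg_right hs2N' (by positivity)
    linarith
  have h3 : -((Nv + s * N'v) * U₂ ^ 2) ≤ (A * c₁ / T ^ 2) * (2 * (c - P)) := by
    obtain ⟨k1, k2⟩ := abs_le.1 hNsN'
    have : 0 ≤ (A * c₁ / T ^ 2 + (Nv + s * N'v)) * U₂ ^ 2 := mul_nonneg (by linarith) (sq_nonneg _)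
    nlinarith
  have : 2 * (A * c₁ / T ^ 2) * (c - P) + (A * c₁ / T ^ 2) * (2 * (c - P)) = 4 * A * c₁ / T ^ 2 * (c - P) := by
    ring
  linarith

/-- **The cap/cut-off error** `E = χ″M(P − c) + 2χ′NρU₂ + χ″MU₂²` on `s ≤ 4T²`, `T > 0`:
with `|χ′|, |χ″| ≤ D`, `|M| ≤ B`, `0 ≤ N ≤ 4`, `ρ² ≤ s (U₀²+U₁²)` and the head sign,
`|E| ≤ (3DB + 32DT) h`. [folklore] -/
theorem density_error_le {χ' χ'' Mv Nv s T D B P c Q U₀ U₁ U₂ x₀ x₁ : ℝ} (hT : 0 < T) (hs4 : s ≤ 4 * T ^ 2)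
    (hsx : s = x₀ ^ 2 + x₁ ^ 2) (hχ' : |χ'| ≤ D) (hχ'' : |χ''| ≤ D) (hM : |Mv| ≤ B) (hN0 : 0 ≤ Nv) (hN4 : Nv ≤ 4)
    (hQ : Q ≤ 0) (hPQ : P - c ≤ Q) (hQdef : Q = P - c + (U₀ ^ 2 + U₁ ^ 2 + U₂ ^ 2) / 2) :
    |χ'' * Mv * (P - c) + 2 * χ' * Nv * ((x₀ * U₀ + x₁ * U₁) * U₂) + χ'' * Mv * U₂ ^ 2| ≤
      (3 * D * B + 32 * D * T) * (c - P) := by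
  have hD0 : 0 ≤ D := (abs_nonneg _).trans hχ'
  have hB0 : 0 ≤ B := (abs_nonneg _).trans hM
  have hh : 0 ≤ c - P := by linarith
  have hU2 : U₀ ^ 2 + U₁ ^ 2 + U₂ ^ 2 ≤ 2 * (c - P) := by nlinarith
  -- `ρ² ≤ s (U₀²+U₁²) ≤ 4T² |U|²`
  have hρ : (x₀ * U₀ + x₁ * U₁) ^ 2 ≤ s * (U₀ ^ 2 + U₁ ^ 2) := by
    rw [hsx, ← rho_sq_add_swirl_sq]; nlinarith [sq_nonneg (x₀ * U₁ - x₁ * U₀)]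
  -- AM–GM: `2|ρ U₂| ≤ ρ²/(2T) + 2T U₂² ≤ 4T |U|² ≤ 8T h`
  have hρU : 2 * |(x₀ * U₀ + x₁ * U₁) * U₂| ≤ 8 * T * (c - P) := by
    set ρ := x₀ * U₀ + x₁ * U₁ with hρdef
    have hsq : ρ ^ 2 ≤ 4 * T ^ 2 * (U₀ ^ 2 + U₁ ^ 2) := hρ.trans (by nlinarith [sq_nonneg U₀, sq_nonneg U₁])
    have k1 : 4 * T * (|ρ| * |U₂|) ≤ ρ ^ 2 + 4 * T ^ 2 * U₂ ^ 2 := by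
      nlinarith [sq_nonneg (|ρ| - 2 * T * |U₂|), sq_abs ρ, sq_abs U₂]
    have k2 : ρ ^ 2 + 4 * T ^ 2 * U₂ ^ 2 ≤ 8 * T ^ 2 * (c - P) := by nlinarith
    rw [abs_mul]
    by_contra hcon
    rw [not_le] at hcon
    nlinarith [mul_lt_mul_of_pos_left hcon (by linarith : (0 : ℝ) < 2 * T)]
  -- the three terms
  have t1 : |χ'' * Mv * (P - c)| ≤ D * B * (c - P) := by
    rw [abs_mul, abs_mul, show |P - c| = c - P by rw [abs_sub_comm]; exact abs_of_nonneg hh]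
    exact mul_le_mul_of_nonneg_right (mul_le_mul hχ'' hM (abs_nonneg _) hD0) hh
  have t2 : |2 * χ' * Nv * ((x₀ * U₀ + x₁ * U₁) * U₂)| ≤ 32 * D * T * (c - P) := by
    rw [abs_mul, abs_mul, abs_mul, abs_two, abs_of_nonneg hN0]
    calc 2 * |χ'| * Nv * |(x₀ * U₀ + x₁ * U₁) * U₂|
        = |χ'| * Nv * (2 * |(x₀ * U₀ + x₁ * U₁) * U₂|) := by ring
      _ ≤ D * 4 * (8 * T * (c - P)) := by
          apply mul_le_mul (mul_le_mul hχ' hN4 hN0 hD0) hρU (by positivity) (by positivity)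
      _ = 32 * D * T * (c - P) := by ring
  have t3 : |χ'' * Mv * U₂ ^ 2| ≤ 2 * D * B * (c - P) := by
    rw [abs_mul, abs_mul, abs_of_nonneg (sq_nonneg U₂)]
    calc |χ''| * |Mv| * U₂ ^ 2 ≤ D * B * (2 * (c - P)) :=
          mul_le_mul (mul_le_mul hχ'' hM (abs_nonneg _) hD0) (by nlinarith [sq_nonneg U₀, sq_nonneg U₁])
            (sq_nonneg _) (by positivity)
      _ = 2 * D * B * (c - P) := by ring
  calc |χ'' * Mv * (P - c) + 2 * χ' * Nv * ((x₀ * U₀ + x₁ * U₁) * U₂) + χ'' * Mv * U₂ ^ 2|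
      ≤ |χ'' * Mv * (P - c)| + |2 * χ' * Nv * ((x₀ * U₀ + x₁ * U₁) * U₂)| + |χ'' * Mv * U₂ ^ 2| :=
        (abs_add_le _ _).trans (add_le_add (abs_add_le _ _) le_rfl)
    _ ≤ D * B * (c - P) + 32 * D * T * (c - P) + 2 * D * B * (c - P) := by linarith
    _ = (3 * D * B + 32 * D * T) * (c - P) := by ring

end Summit.NavierStokesRegularity.NavierStokesRegularity.Theorems.GaldiLiouville.AllAxesBudget

end
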